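import Literature.AnabelianGeometry.EtaleTheta.LogDivisorModelTateTowerThetaTwistTowerRootLaw
import Literature.AnabelianGeometry.EtaleTheta.LogDivisorModelTateTowerKummerTwistCompatRShearTempered
import Literature.AnabelianGeometry.EtaleTheta.Discharge.Sec3Prop34Cnst0UnitTrivialAutObstruction
import Literature.AlgebraicGeometry.Frobenioids.QuasiTemperoidConnectedPart
import HarnessLib

/-!
# [EtTh] Prop. 3.4 (ii) / Thm. 3.7 (iii) at the (β) 2c theta-twist towers `towerC₃`, `towerC₃sf`: the `D^cnst`-naturality bundle
# `Prop34Cnst₀` is UNSATISFIABLE there for EVERY constant-field functor — the torsion-units obstruction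

S. Mochizuki, *The étale theta function and its Frobenioid-theoretic manifestations*, Publ. RIMS **45** (2009)
[MochizukiEtTh2009], §3 Prop. 3.4 (ii) p.74 («`O_L^× ⥲ Ker(B₀(Y^log) → Φ₀^gp(Y^log))`, …, `L^× ⥲ F₀(Y^log)`»), Thm. 3.7 (iii)
pp.79–80 («Then the natural action of `Aut_C(A)` on `O^×(A)`, `O^▷(A)` factors through `Aut_{D^cnst}(A^cnst)`. If, moreover,
`Λ ∈ {ℤ, ℚ}`, then this factorization is faithful»; print's proof of (iii) reads «follows immediately from the definitions»)
[cite: MochizukiEtTh2009, Prop 3.4 (ii) p.74] [cite: MochizukiEtTh2009, Thm 3.7 (iii) p.79].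

PROOF-ONLY (theorems only, 0 definitions; abc-iut cell, layer L2; seat abc-iut-w5-d034 gen 8, by-name row «PROP34CNST₀ OBSTRUCTION AT
THE 2c TOWER», abc-iut-L2-lead gen 7 R1008).  Consumed BY NAME, nothing restated: this lineage's obstruction schema
`DivisorMonoids.not_prop34Cnst₀_of_unitTrivial_aut` (p488276); abc-iut-L2-t3's `towerC₃` (p487602), its ε-free restriction
`towerC₃sf` (p488792, the (β) 2c tower of record) and quotient coverings `quotCoverC₃` / `le_lvlC_quotCoverC₃` (p490708); abc-iut-L1-t6's
open normal subgroups `vSub` of «GRP₃′»'s compatible part (`…CompatRShearTempered`); abc-iut-w6-d048 / abc-iut-w6-d058's `exists_bZero_quotient_of_invariant`,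
`divZeroHom_eq_one_iff_divAt`; the generic v2 tower interface `LogDivisorTower` / `DivisorMonoids.ofTower`.

WHAT.
* §1 `LogDivisorTower.forall_not_prop34Cnst₀_of_unitTrivial_elt` — a GENERIC ENGINE over ANY log-divisor tower `T` (any tempered `Π`, any
  level system): a connected covering `Y` with a point `y₀`, and a group element `κ` normalising the stabiliser of `y₀`, FIXING every
  divisor-trivial function of the level of `Y` but MOVING the (constant) value at `y₀` of some `b₀ ∈ B₀(Y)`, make `Prop34Cnst₀ (ofTower T) cnst`
  FALSE for every constant-field functor `cnst` — the deck transformation `y₀ ↦ κ·y₀` of `Y` is the unit-invisible, constant-moving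
  automorphism of the schema (it is an isomorphism by `BTempConnected.isIso_of_bijective`).
* §2 the (β) 2c towers: `levelActFnMod_eq_one_of_mem_vSub` — abc-iut-L1-t6's `V_n = vSub 3 thetaShear n` acts trivially at every level
  `m ≤ n` (COMPATIBILITY `k_m ≡ k_{m−1} = 0`, `c_m ≡ c_{m−1} = 1 (mod M_{m−1} = N_m)`); `exists_cover_vSub` — the connected covering
  `Compat₃′/V_n` has level EXACTLY `n`, base point with stabiliser `V_n`, and carries every `V_n`-invariant value as a `B₀`-section;
  `kummerAut_eq_self_of_divisor_eq_one` — a function of a `Ÿ`-level with trivial log-divisor has vanishing root exponents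
  (`divisor_eq_one_iff`: `O^▷ ∩ (O^▷)⁻¹`), so EVERY Kummer class fixes it; `exists_kumUnifC` — the compatible `ϖ̈`-Kummer generator.
* §3 **`forall_not_prop34Cnst₀_towerC₃`**, **`forall_not_prop34Cnst₀_towerC₃sf`**: at `Y := Compat₃′/V_1` (level `1`, roots of unity `μ_2`)
  the deck transformation by the `ϖ̈`-Kummer generator `κ_ϖ` fixes every unit function (their values are torsion, `pairing κ = 0`) and sends
  the constant `ϖ̈_1` to `ζ_2 · ϖ̈_1 = −ϖ̈_1 ≠ ϖ̈_1` (`kummerAut_unif`); hence `¬ Prop34Cnst₀ (ofTower towerC₃) cnst` and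
  `¬ Prop34Cnst₀ (ofTower towerC₃sf) cnst` for EVERY `(D^cnst, cnst)` — [EtTh] Thm. 3.7 (iii) AS TYPED over `Prop34Cnst₀` has no instance
  at the 2c towers.
READING (words, not kernel).  Clause 3 of `Prop34Cnst₀` transcribes «faithful» as «`Aut_{D^cnst}(Y^cnst)` is detected on the UNIT
functions `Ker(B₀ → Φ₀^gp)`»; in print this holds because `Aut(L/K)` acts faithfully on `O_L^× ∋ 1 + ϖ^{1/N}` (OUR reading of the
standard reason; print says «immediately from the definitions»); a class-(b) level records as units only the roots of unity `μ_{N_m}`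
(× the sign `μ₂` for `towerC₃`), on which the Galois element `ϖ̈_m ↦ ζ ϖ̈_m` of the constant field `K(ζ, ϖ^{1/N_m})` is invisible.
Interface repair options (abc-iut-L2-lead's call, booked 2026-08-27): (R1) weaken clause 3 to «acting identically on `F₀(Y)`»;
(R2) record a faithful unit part (principal units) in the level model.
HONEST FRAMING: kernel facts about OUR typed interface `Prop34Cnst₀` × OUR class-(b) design towers; they take no side on [IUTchIII]
Cor. 3.12 and say nothing about print's Thm. 3.7 (iii) (true in print); nothing here asserts abc proved or refuted; typed ≠ proved.
-/

noncomputable section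

namespace Literature.AnabelianGeometry.EtaleTheta

open CategoryTheory Opposite Function Literature.AlgebraicGeometry.Frobenioids
  Literature.AlgebraicGeometry.Frobenioids.QuasiTemperoid Literature.AnabelianGeometry.SemiGraphs

universe u u₁ v₁

/-! ## §1 The generic engine: a unit-invisible, constant-moving group element kills `Prop34Cnst₀ (ofTower T)` -/

namespace LogDivisorTower

variable {P : Type u} [Group P] [TopologicalSpace P] {L : LevelSystem P} (T : LogDivisorTower P L)

/-- **Generic obstruction engine** ([EtTh] Prop. 3.4 (ii) / Thm. 3.7 (iii) at the Def. 3.3 (iii) data `ofTower T` of ANY log-divisor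
tower).  Let `Y` be a connected tempered covering with a point `y₀` (so `Y = Π · y₀`) and `κ ∈ Π` an element normalising the
stabiliser of `y₀`; suppose `κ` FIXES every log-meromorphic function of the level of `Y` with trivial log-divisor, and MOVES the value
at `y₀` — a constant — of some `b₀ ∈ B₀(Y)`.  Then the deck transformation `y₀ ↦ κ · y₀` is an automorphism of `Y` acting identically on
`Ker(B₀(Y) → Φ₀^gp(Y))` but not on `F₀(Y) ∋ b₀`, so (`DivisorMonoids.not_prop34Cnst₀_of_unitTrivial_aut`) NO constant-field functor
`cnst : D₀ ⥤ D^cnst` satisfies `Prop34Cnst₀`. [cite: MochizukiEtTh2009, Thm 3.7 (iii) p.79] -/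
theorem forall_not_prop34Cnst₀_of_unitTrivial_elt (Y : ConnectedPart (BTemp P)) (y₀ : Y.obj.obj.V)
    (htr : ∀ y : Y.obj.obj.V, ∃ x : P, Y.obj.obj.ρ x y₀ = y) (κ : P)
    (hκ₁ : ∀ x : P, Y.obj.obj.ρ x y₀ = y₀ → Y.obj.obj.ρ (κ⁻¹ * x * κ) y₀ = y₀)
    (hκ₂ : ∀ x : P, Y.obj.obj.ρ x y₀ = y₀ → Y.obj.obj.ρ (κ * x * κ⁻¹) y₀ = y₀)
    (hunit : ∀ (u : (T.Z (L.lvl Y)).Fn) (hu : u ∈ (T.Z (L.lvl Y)).logMero),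
      (T.Z (L.lvl Y)).divisor ⟨u, hu⟩ = 1 → (T.act (L.lvl Y)).actFn κ u = u)
    (b₀ : (T.act (L.lvl Y)).bZero (gset Y)) (hb₀ : b₀.1 y₀ ∈ (T.Z (L.lvl Y)).const)
    (hmove : (T.act (L.lvl Y)).actFn κ (b₀.1 y₀) ≠ b₀.1 y₀)
    (Dc : Type u₁) [Category.{v₁} Dc] (cnst : ConnectedPart (BTemp P) ⥤ Dc) :
    ¬ (DivisorMonoids.ofTower T).Prop34Cnst₀ cnst := by
  -- the deck transformation `y₀ ↦ κ · y₀` (the stabiliser of `y₀` fixes `κ · y₀` since `κ` normalises it)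
  obtain ⟨f₀, hf₀⟩ := BTempConnected.exists_hom_of_stabilizer_le (T₁ := Y.obj) (T₂ := Y.obj) y₀ htr (Y.obj.obj.ρ κ y₀)
    (fun x hx => by
      rw [← BTempConnected.ρ_mul_apply, show x * κ = κ * (κ⁻¹ * x * κ) by group, BTempConnected.ρ_mul_apply, hκ₁ x hx])
  have hf : ∀ x : P, (f₀.hom.hom (Y.obj.obj.ρ x y₀) : Y.obj.obj.V) = Y.obj.obj.ρ (x * κ) y₀ := fun x => by
    rw [BTempConnected.hom_ρ, hf₀, ← BTempConnected.ρ_mul_apply]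
  -- it is injective (the stabiliser of `y₀` is stable under conjugation by `κ`) …
  have hinj : Function.Injective fun y : Y.obj.obj.V => (f₀.hom.hom y : Y.obj.obj.V) := by
    intro y y' hyy'
    obtain ⟨x, rfl⟩ := htr y
    obtain ⟨x', rfl⟩ := htr y'
    change (f₀.hom.hom (Y.obj.obj.ρ x y₀) : Y.obj.obj.V) = f₀.hom.hom (Y.obj.obj.ρ x' y₀) at hyy'
    rw [hf, hf] at hyy'
    have h1 : Y.obj.obj.ρ ((x * κ)⁻¹ * (x' * κ)) y₀ = y₀ := by
      rw [BTempConnected.ρ_mul_apply, ← hyy', BTempConnected.ρ_inv_apply]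
    have h2 := hκ₂ _ h1
    rw [show κ * ((x * κ)⁻¹ * (x' * κ)) * κ⁻¹ = x⁻¹ * x' by group] at h2
    calc Y.obj.obj.ρ x y₀ = Y.obj.obj.ρ x (Y.obj.obj.ρ (x⁻¹ * x') y₀) := by rw [h2]
      _ = Y.obj.obj.ρ x' y₀ := by rw [← BTempConnected.ρ_mul_apply, mul_inv_cancel_left]
  -- … and surjective (every arrow of `B^temp(Π)⁰` is), hence an automorphism of `Y`
  let f : Y ⟶ Y := ObjectProperty.homMk f₀
  haveI : IsIso f₀ := BTempConnected.isIso_of_bijective f₀ ⟨hinj, BTempConnected.connectedPart_hom_surjective f⟩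
  haveI : IsIso f := (ObjectProperty.isIso_hom_iff f).mp (show IsIso f₀ from inferInstance)
  -- the pull-back along an endomorphism of `Y` involves the identity level change
  have hres : ∀ z : (T.Z (L.lvl Y)).Fn, T.resFn (L.closure_lvl_mono f) z = z := fun z => T.resFn_refl (L.lvl Y) z
  refine (DivisorMonoids.ofTower T).not_prop34Cnst₀_of_unitTrivial_aut (asIso f) (fun b hdiv => ?_) (b₀ := b₀) ?_ ?_ cnst
  · -- `g` is invisible on the unit functions: their values have trivial divisor, so `κ` fixes `b(y₀)`
    change (T.act (L.lvl Y)).divZeroHom (gset Y) b = 1 at hdiv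
    have hdiv' : ∀ s, (T.Z (L.lvl Y)).divisor ⟨b.1 s, b.2.1 s⟩ = 1 :=
      ((T.act (L.lvl Y)).divZeroHom_eq_one_iff_divAt (gset Y) b).1 hdiv
    have hfix : (T.act (L.lvl Y)).actFn κ (b.1 y₀) = b.1 y₀ := hunit (b.1 y₀) (b.2.1 y₀) (hdiv' y₀)
    refine Subtype.ext (funext fun s => ?_)
    obtain ⟨x, rfl⟩ := htr s
    change T.resFn (L.closure_lvl_mono f) (b.1 (f₀.hom.hom (Y.obj.obj.ρ x y₀))) = b.1 (Y.obj.obj.ρ x y₀)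
    rw [hres, hf, b.2.2, b.2.2, map_mul, MulAut.mul_apply, hfix]
  · -- `b₀ ∈ F₀(Y)`: its values are the translates of the constant `b₀(y₀)`
    change b₀ ∈ (T.act (L.lvl Y)).fZero (gset Y)
    rw [LogDivisorModel.GaloisAction.mem_fZero_iff]
    intro s
    obtain ⟨x, rfl⟩ := htr s
    rw [b₀.2.2]
    exact (T.act (L.lvl Y)).act_mem_const x hb₀
  · -- `g` moves `b₀`: evaluate at `y₀`
    intro h
    have h1 := congrArg (fun β : (T.act (L.lvl Y)).bZero (gset Y) => β.1 y₀) h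
    change T.resFn (L.closure_lvl_mono f) (b₀.1 (f₀.hom.hom y₀)) = b₀.1 y₀ at h1
    rw [hres, hf₀, b₀.2.2] at h1
    exact hmove h1

end LogDivisorTower

/-! ## §2 The (β) 2c towers: `V_n` acts trivially below level `n`; the covering `Compat₃′/V_n`; Kummer classes fix units -/

namespace LogDivisorModel

namespace TateTowerThetaTwist

open TateTowerTheta
open TateTowerKummerTwist (M Cst N coe_N N_dvd_M res resC)
open TateTowerKummerTwistR (Kum)
open TateTowerKummerTwistRShear (Grp thetaShear compat Compat closureC mem_closureC_iff levelsC lvlC lvlC_le mem_closure_iff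
  res_coord_eq resC_right_eq vSub vSub_normal isOpen_vSub countable_quotient_vSub)

/-- `Δ_n ∩ Compat ⊆ V_n` (both have trivial translation, trivial character values and classes of index `< n`).
[cite: MochizukiEtTh2009, Def 3.3 (i) p.72] -/
theorem closureC_le_vSub₃ (n : ℕ) : closureC 3 thetaShear n ≤ vSub 3 thetaShear n := fun g hg => by
  obtain ⟨hright, hk⟩ := (mem_closure_iff 3 thetaShear n (g : Grp 3 thetaShear)).1 ((mem_closureC_iff 3 thetaShear n g).1 hg)
  exact ⟨by rw [hright, Prod.snd_one], fun i hi => ⟨hk i hi, by rw [hright, Prod.fst_one, Pi.one_apply]⟩⟩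

/-- **`V_n` acts trivially at every level `m ≤ n`**: for `v ∈ V_n` the index-`m` class triple and character value READ MODULO
`N_m = M_{m−1}` are the (trivial) index-`(m−1)` data by COMPATIBILITY, and the translation is trivial.
[cite: MochizukiEtTh2009, Def 3.3 (ii) p.73] -/
theorem levelActFnMod_eq_one_of_mem_vSub {n m : ℕ} (hm : m ≤ n) {v : Compat 3 thetaShear} (hv : v ∈ vSub 3 thetaShear n) :
    levelActFnMod m (N m) (N_dvd_M m) (v : Grp 3 thetaShear) = 1 := by
  obtain ⟨h2, hc⟩ := hv
  -- the index-`m` classes vanish modulo `N m`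
  have hk : ∀ a, ZMod.castHom (N_dvd_M m) (ZMod (N m)) (Multiplicative.toAdd (v : Grp 3 thetaShear).left m a) = 0 := by
    intro a
    rcases m with _ | k
    · haveI : Subsingleton (ZMod (N 0)) := ZMod.subsingleton_iff.2 rfl
      exact Subsingleton.elim _ _
    · have h0 : (v : Grp 3 thetaShear).left.toAdd k a = 0 := by
        rw [(hc k (Nat.lt_of_succ_le hm)).1, Pi.zero_apply]
      have hres := res_coord_eq 3 thetaShear v (show k ≤ k + 1 from Nat.le_succ k) a
      rw [h0] at hres
      exact (RingHom.congr_fun (Subsingleton.elim (ZMod.castHom (N_dvd_M (k + 1)) (ZMod (N (k + 1))))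
        (res (show k ≤ k + 1 from Nat.le_succ k))) _).trans hres
  -- the index-`m` character value is `1` modulo `N m`
  have hch : ZMod.castHom (N_dvd_M m) (ZMod (N m)) (((v : Grp 3 thetaShear).right.1 m : (ZMod (M m))ˣ) : ZMod (M m)) = 1 := by
    rcases m with _ | k
    · haveI : Subsingleton (ZMod (N 0)) := ZMod.subsingleton_iff.2 rfl
      exact Subsingleton.elim _ _
    · have hres := resC_right_eq 3 thetaShear v (show k ≤ k + 1 from Nat.le_succ k)
      rw [(hc k (Nat.lt_of_succ_le hm)).2] at hres
      have hval : ((resC (show k ≤ k + 1 from Nat.le_succ k) ((v : Grp 3 thetaShear).right.1 (k + 1)) : (ZMod (M k))ˣ) :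
          ZMod (M k)) = 1 := by
        rw [hres, Units.val_one]
      exact (RingHom.congr_fun (Subsingleton.elim (ZMod.castHom (N_dvd_M (k + 1)) (ZMod (N (k + 1))))
        (res (show k ≤ k + 1 from Nat.le_succ k))) _).trans hval
  have hK : kumActMod m (N m) (N_dvd_M m) (v : Grp 3 thetaShear).left = 1 := by
    refine MulEquiv.ext fun x => ?_
    rw [kumActMod_apply, MulAut.one_apply,
      show (fun i => ZMod.castHom (N_dvd_M m) (ZMod (N m)) (Multiplicative.toAdd (v : Grp 3 thetaShear).left m i)) = 0 from funext hk,
      kummerAut_zero]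
    rfl
  have hC : levelCharMod m (N m) (N_dvd_M m) (v : Grp 3 thetaShear).right.1 = 1 := by
    refine MulEquiv.ext fun z => ?_
    rw [levelCharMod_apply, hch, one_mul, MulAut.one_apply]
    rfl
  rw [levelActFnMod_apply, h2, map_one, mul_one, hK, hC, map_one, mul_one]

/-- `V_n` acts trivially at the levels `m ≤ n` of `towerC₃`. [cite: MochizukiEtTh2009, Def 3.3 (ii) p.73] -/
theorem towerC₃_actFn_eq_one_of_mem_vSub {n m : ℕ} (hm : m ≤ n) {v : Compat 3 thetaShear} (hv : v ∈ vSub 3 thetaShear n) :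
    (towerC₃.act m).actFn v = 1 := by
  change levelActFnMod m (N m) (N_dvd_M m) (v : Grp 3 thetaShear) = 1
  exact levelActFnMod_eq_one_of_mem_vSub hm hv

/-- `V_n` acts trivially at the levels `m ≤ n` of the ε-free tower `towerC₃sf`. [cite: MochizukiEtTh2009, Def 3.3 (ii) p.73] -/
theorem towerC₃sf_actFn_eq_one_of_mem_vSub {n m : ℕ} (hm : m ≤ n) {v : Compat 3 thetaShear} (hv : v ∈ vSub 3 thetaShear n) :
    (towerC₃sf.act m).actFn v = 1 :=
  LogDivisorModel.GaloisAction.restrict_actFn_eq_one _ _ (towerC₃_actFn_eq_one_of_mem_vSub hm hv)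

/-- **The connected tempered covering `Y_n := Compat₃′/V_n`** (abc-iut-L2-t3's `quotCoverC₃` at abc-iut-L1-t6's `vSub`): it has level
EXACTLY `n`, it is the orbit of a point `y₀` whose stabiliser is `V_n`, and every `V_n`-invariant log-meromorphic value `u` of any level
of any tower over `Compat₃′` is the value at `y₀` of a section `b ∈ B₀(Y_n)` (Def. 3.3 (iii)'s `B₀(Y) = Mero^{Gal}` at this term).
[cite: MochizukiEtTh2009, Def 3.3 (iii) p.73] -/
theorem exists_cover_vSub (n : ℕ) :
    ∃ (Y : ConnectedPart (BTemp (Compat 3 thetaShear))) (y₀ : Y.obj.obj.V), lvlC 3 thetaShear Y = n ∧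
      (∀ y : Y.obj.obj.V, ∃ x : Compat 3 thetaShear, Y.obj.obj.ρ x y₀ = y) ∧
      (∀ x : Compat 3 thetaShear, Y.obj.obj.ρ x y₀ = y₀ ↔ x ∈ vSub 3 thetaShear n) ∧
      ∀ (T : LogDivisorTower (Compat 3 thetaShear) (levelsC 3 thetaShear)) (i : ℕ) (u : (T.Z i).Fn), u ∈ (T.Z i).logMero →
        (∀ v ∈ vSub 3 thetaShear n, (T.act i).actFn v u = u) → ∃ b : (T.act i).bZero Y.obj.obj, b.1 y₀ = u := by
  have e1 : ∀ x : Compat 3 thetaShear, (x : Compat 3 thetaShear ⧸ vSub 3 thetaShear n) =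
      (Action.ofMulAction (Compat 3 thetaShear) (Compat 3 thetaShear ⧸ vSub 3 thetaShear n)).ρ x
        ((1 : Compat 3 thetaShear) : Compat 3 thetaShear ⧸ vSub 3 thetaShear n) := fun x => by
    rw [Action.ofMulAction_apply, MulAction.Quotient.smul_coe, smul_eq_mul, mul_one]
  refine ⟨quotCoverC₃ (vSub 3 thetaShear n) (isOpen_vSub 3 thetaShear n) (countable_quotient_vSub 3 thetaShear n),
    ((1 : Compat 3 thetaShear) : Compat 3 thetaShear ⧸ vSub 3 thetaShear n), ?_, ?_, ?_, ?_⟩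
  · -- level `≤ n`: the normal subgroup `Δ_n ∩ Compat ⊆ V_n` fixes every coset; `≥ n`: `V_n ⊆ kumLevelC₃ n`
    refine le_antisymm (lvlC_le 3 thetaShear fun g hg y => ?_)
      (le_lvlC_quotCoverC₃ _ _ _ fun g hg i hi => (hg.2 i hi).1)
    induction y using QuotientGroup.induction_on with
    | H x =>
      refine (ofMulAction_quot_fix_iff₃ (vSub 3 thetaShear n) x g).2 ?_
      have h := (vSub_normal 3 thetaShear n).conj_mem g (closureC_le_vSub₃ n hg) x⁻¹
      rwa [inv_inv] at h
  · intro y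
    induction y using QuotientGroup.induction_on with
    | H x => exact ⟨x, (e1 x).symm⟩
  · intro x
    refine (ofMulAction_quot_fix_iff₃ (vSub 3 thetaShear n) 1 x).trans ?_
    rw [inv_one, one_mul, mul_one]
  · intro T i u hu hinv
    exact (T.act i).exists_bZero_quotient_of_invariant (vSub 3 thetaShear n) hu hinv

/-- **Every Kummer class fixes the functions with trivial log-divisor**: a function `u` of a `Ÿ`-level with `div u = 1` lies in
`O^▷ ∩ (O^▷)⁻¹` (`divisor_eq_one_iff`, Prop. 3.2 (ii)), so its three root exponents vanish and the Kummer pairing `κ · e(u)` is `0`.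
[cite: MochizukiEtTh2009, Prop 3.2 p.70] -/
theorem kummerAut_eq_self_of_divisor_eq_one {B : Type} [AddCommGroup B] [Finite B] (κ : Fin 3 → B) (u : Fn (Multiplicative B))
    (hu : (model (Multiplicative B)).divisor ⟨u, trivial⟩ = 1) : kummerAut κ u = u := by
  obtain ⟨h1, h2⟩ := ((model (Multiplicative B)).divisor_eq_one_iff ⟨u, trivial⟩).1 hu
  have ha : 0 ≤ eC (Multiplicative.toAdd u.2) := h1.1
  have hb : 0 ≤ -eC (Multiplicative.toAdd u.2) := h2.1
  have hC : eC (Multiplicative.toAdd u.2) = 0 := le_antisymm (neg_nonneg.1 hb) ha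
  have hU : eU (Multiplicative.toAdd u.2) = 0 := h1.2.1
  have hT : eT (Multiplicative.toAdd u.2) = 0 := h1.2.2
  have hp : pairing κ (Multiplicative.toAdd u.2) = 0 := by
    rw [pairing, hC, hU, hT, zero_zsmul, zero_zsmul, zero_zsmul, add_zero, add_zero]
  exact Prod.ext (by rw [kummerAut_fst, hp, ofAdd_zero, mul_one]) (kummerAut_snd κ u)

/-- **The compatible `ϖ̈`-KUMMER generator `κ_ϖ` of «GRP₃′»** (class `1` at every index in the `ϖ̈`-coordinate, trivial constants, no
translation) exists in the compatible part (cf. abc-iut-L2-t3's `kumThetaC` for the `Θ̈`-coordinate). [cite: MochizukiEtTh2009, Def 3.3 (ii) p.73] -/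
theorem exists_kumUnifC : ∃ (κ : Compat 3 thetaShear) (k : Kum 3), (κ : Grp 3 thetaShear) = SemidirectProduct.inl k ∧
    ∀ n, Multiplicative.toAdd k n = Pi.single (0 : Fin 3) (1 : ZMod (M n)) := by
  refine ⟨⟨SemidirectProduct.inl (Multiplicative.ofAdd fun n => Pi.single (0 : Fin 3) (1 : ZMod (M n))), ?_⟩, _, rfl, fun n => rfl⟩
  refine ⟨fun i j h => ?_, fun i j h => ?_⟩
  · rw [SemidirectProduct.left_inl, toAdd_ofAdd]
    ext a
    rw [TateTowerKummerTwistR.resK_apply]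
    by_cases ha : a = 0
    · subst ha; rw [Pi.single_eq_same, Pi.single_eq_same, map_one]
    · rw [Pi.single_eq_of_ne ha, Pi.single_eq_of_ne ha, map_zero]
  · rw [SemidirectProduct.right_inl, Prod.fst_one, Pi.one_apply, Pi.one_apply, map_one]

/-- A compatible Kummer element with index-`m` class triple `(1, 0, 0)` acts on the functions of level `m` by the class triple
`(1, 0, 0) ∈ (ℤ/N_m)³` (classes READ MODULO `N_m`). [cite: MochizukiEtTh2009, Def 3.3 (ii) p.73] -/
theorem levelActFnMod_kumUnif (m : ℕ) {κ : Compat 3 thetaShear} {k : Kum 3} (hκ : (κ : Grp 3 thetaShear) = SemidirectProduct.inl k)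
    (hk : Multiplicative.toAdd k m = Pi.single (0 : Fin 3) (1 : ZMod (M m))) (u : Fn (Mu₃ m)) :
    levelActFnMod m (N m) (N_dvd_M m) (κ : Grp 3 thetaShear) u = kummerAut (Pi.single (0 : Fin 3) (1 : ZMod (N m))) u := by
  have hF : (fun i => ZMod.castHom (N_dvd_M m) (ZMod (N m)) (Multiplicative.toAdd k m i)) = Pi.single (0 : Fin 3) (1 : ZMod (N m)) := by
    funext i
    rw [hk]
    by_cases hi : i = 0
    · subst hi; rw [Pi.single_eq_same, Pi.single_eq_same, map_one]
    · rw [Pi.single_eq_of_ne hi, Pi.single_eq_of_ne hi, map_zero]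
  rw [hκ, levelActFnMod_inl, kumActMod_apply, hF]

/-- The `ϖ̈`-Kummer generator MOVES `ϖ̈_m` at every level `m ≥ 1`: `ϖ̈_m ↦ ζ_{N_m} ϖ̈_m` with `ζ_{N_m} ≠ 1` (`N_m = (m+1)! ≥ 2`).
[cite: MochizukiEtTh2009, §1 p.13] -/
theorem kummerAut_single_unif_ne {m : ℕ} (hm : 1 ≤ m) :
    kummerAut (Pi.single (0 : Fin 3) (1 : ZMod (N m))) (unif (Mu₃ m)) ≠ unif (Mu₃ m) := by
  rw [kummerAut_unif, Pi.single_eq_same]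
  intro h
  have h1 : Multiplicative.ofAdd (1 : ZMod (N m)) = 1 := congrArg Prod.fst h
  haveI : Fact (1 < ((N m : ℕ+) : ℕ)) := ⟨by
    rw [coe_N]
    calc 1 < 2 := by norm_num
      _ = Nat.factorial 2 := rfl
      _ ≤ Nat.factorial (m + 1) := Nat.factorial_le (by omega)⟩
  exact one_ne_zero (ofAdd_eq_one.mp h1)

/-! ## §3 The obstruction at the 2c towers: `Prop34Cnst₀` fails for EVERY constant-field functor -/

/-- **`Prop34Cnst₀ (ofTower towerC₃) cnst` is FALSE for every `(D^cnst, cnst)`** — [EtTh] Prop. 3.4 (ii)'s bundle AS TYPED (clause 3: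
automorphisms agreeing on the unit functions have the same image in `D^cnst`) at abc-iut-L2-t3's sign-carrying 2c tower: at
`Y := Compat₃′/V_1` the deck transformation by the `ϖ̈`-Kummer generator fixes every unit function (values in `μ_2 × μ₂`, Kummer pairing
`0`) but sends the constant section through `ϖ̈_1` to `−ϖ̈_1`.  Hence Thm. 3.7 (iii) AS TYPED over `Prop34Cnst₀` has no instance there.
[cite: MochizukiEtTh2009, Thm 3.7 (iii) p.79] -/
theorem forall_not_prop34Cnst₀_towerC₃ (Dc : Type u₁) [Category.{v₁} Dc] (cnst : ConnectedPart (BTemp (Compat 3 thetaShear)) ⥤ Dc) :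
    ¬ (DivisorMonoids.ofTower towerC₃).Prop34Cnst₀ cnst := by
  obtain ⟨Y, y₀, hl, htr, hstab, hb⟩ := exists_cover_vSub 1
  obtain ⟨κ, k, hκ, hk⟩ := exists_kumUnifC
  -- `lvl Y = lvlC Y = 1`; keep the level symbolic and use `hl` only for `≤ 1` / `≥ 1`
  have hinv : ∀ v ∈ vSub 3 thetaShear 1,
      (towerC₃.act (lvlC 3 thetaShear Y)).actFn v (unif (Mu₃ (lvlC 3 thetaShear Y))) = unif (Mu₃ (lvlC 3 thetaShear Y)) :=
    fun v hv => by rw [towerC₃_actFn_eq_one_of_mem_vSub hl.le hv, MulAut.one_apply]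
  obtain ⟨b₀, hb₀⟩ := hb towerC₃ (lvlC 3 thetaShear Y) (unif (Mu₃ (lvlC 3 thetaShear Y))) trivial hinv
  refine towerC₃.forall_not_prop34Cnst₀_of_unitTrivial_elt Y y₀ htr κ (fun x hx => (hstab _).2 ?_) (fun x hx => (hstab _).2 ?_)
    (fun u hu hdiv => ?_) b₀ ?_ ?_ Dc cnst
  · have h := (vSub_normal 3 thetaShear 1).conj_mem x ((hstab x).1 hx) κ⁻¹
    rwa [inv_inv] at h
  · exact (vSub_normal 3 thetaShear 1).conj_mem x ((hstab x).1 hx) κ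
  · change levelActFnMod (lvlC 3 thetaShear Y) (N (lvlC 3 thetaShear Y)) (N_dvd_M (lvlC 3 thetaShear Y)) (κ : Grp 3 thetaShear) u = u
    rw [levelActFnMod_kumUnif _ hκ (hk _)]
    exact kummerAut_eq_self_of_divisor_eq_one _ u hdiv
  · rw [hb₀]
    exact unif_mem_const _
  · rw [hb₀]
    change levelActFnMod (lvlC 3 thetaShear Y) (N (lvlC 3 thetaShear Y)) (N_dvd_M (lvlC 3 thetaShear Y)) (κ : Grp 3 thetaShear)
      (unif (Mu₃ (lvlC 3 thetaShear Y))) ≠ unif (Mu₃ (lvlC 3 thetaShear Y))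
    rw [levelActFnMod_kumUnif _ hκ (hk _)]
    exact kummerAut_single_unif_ne hl.ge

/-- **`Prop34Cnst₀ (ofTower towerC₃sf) cnst` is FALSE for every `(D^cnst, cnst)`** — the same witness at the ε-free (β) 2c tower OF
RECORD `towerC₃sf` (E2-capable; `rootLawC₃sf`): at `Y := Compat₃′/V_1` the `ϖ̈`-Kummer deck transformation is invisible on the unit
functions (values in `μ_2`) and moves the constant section through `ϖ̈_1`.  Hence [EtTh] Thm. 3.7 (iii) AS TYPED over `Prop34Cnst₀`
is unsatisfiable at the 2c tower of record, for every constant-field functor (not only the constant ones).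
[cite: MochizukiEtTh2009, Thm 3.7 (iii) p.79] -/
theorem forall_not_prop34Cnst₀_towerC₃sf (Dc : Type u₁) [Category.{v₁} Dc]
    (cnst : ConnectedPart (BTemp (Compat 3 thetaShear)) ⥤ Dc) :
    ¬ (DivisorMonoids.ofTower towerC₃sf).Prop34Cnst₀ cnst := by
  obtain ⟨Y, y₀, hl, htr, hstab, hb⟩ := exists_cover_vSub 1
  obtain ⟨κ, k, hκ, hk⟩ := exists_kumUnifC
  -- the ε-free function `ϖ̈_m` of the level of `Y`, fixed by `V_1`
  let w : (towerC₃sf.Z (lvlC 3 thetaShear Y)).Fn :=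
    ⟨unif (Mu₃ (lvlC 3 thetaShear Y)), (generators_mem_epsKer (ZMod (N (lvlC 3 thetaShear Y))) 1).1⟩
  have hinv : ∀ v ∈ vSub 3 thetaShear 1, (towerC₃sf.act (lvlC 3 thetaShear Y)).actFn v w = w :=
    fun v hv => by rw [towerC₃sf_actFn_eq_one_of_mem_vSub hl.le hv, MulAut.one_apply]
  obtain ⟨b₀, hb₀⟩ := hb towerC₃sf (lvlC 3 thetaShear Y) w trivial hinv
  refine towerC₃sf.forall_not_prop34Cnst₀_of_unitTrivial_elt Y y₀ htr κ (fun x hx => (hstab _).2 ?_) (fun x hx => (hstab _).2 ?_)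
    (fun u hu hdiv => Subtype.ext ?_) b₀ ?_ ?_ Dc cnst
  · have h := (vSub_normal 3 thetaShear 1).conj_mem x ((hstab x).1 hx) κ⁻¹
    rwa [inv_inv] at h
  · exact (vSub_normal 3 thetaShear 1).conj_mem x ((hstab x).1 hx) κ
  · change levelActFnMod (lvlC 3 thetaShear Y) (N (lvlC 3 thetaShear Y)) (N_dvd_M (lvlC 3 thetaShear Y)) (κ : Grp 3 thetaShear) u.1 = u.1
    rw [levelActFnMod_kumUnif _ hκ (hk _)]
    exact kummerAut_eq_self_of_divisor_eq_one _ u.1 hdiv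
  · rw [hb₀]
    exact (LogDivisorModel.mem_restrict_const_iff _ _ _).2 (unif_mem_const _)
  · rw [hb₀]
    intro h
    have h1 := congrArg Subtype.val h
    change levelActFnMod (lvlC 3 thetaShear Y) (N (lvlC 3 thetaShear Y)) (N_dvd_M (lvlC 3 thetaShear Y)) (κ : Grp 3 thetaShear)
      (unif (Mu₃ (lvlC 3 thetaShear Y))) = unif (Mu₃ (lvlC 3 thetaShear Y)) at h1
    rw [levelActFnMod_kumUnif _ hκ (hk _)] at h1
    exact kummerAut_single_unif_ne hl.ge h1

end TateTowerThetaTwist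

end LogDivisorModel

end Literature.AnabelianGeometry.EtaleTheta

end
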